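import Literature.NumberTheory.Automorphic.BrandtXiSetupIndependence
import HarnessLib

/-!
# The Brandt data of type `(N⁺, N⁻)` are canonical up to reindexing

Topic `NumberTheory/Automorphic`; theorems only (no definition, no named fact, no instance).
`BrandtXiSetupIndependence.lean` proved that Pollack–Weston's `ξ(N⁺, N⁻)` does not depend on
the Brandt setup (`Brandt.XiSetup.xi_eq_xi`, `Brandt.XiSetup.brandtXi_eq_xi`). The same inputs
(uniqueness of the quaternion algebra, local conjugacy of Eichler orders of the same level,
connecting ideals) give the finer statement that the *whole Brandt data* — class set, weights and
all Brandt matrices — of any two setups of type `(N⁺, N⁻)` correspond under a bijection of class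
sets:

* `Brandt.XiSetup.nonempty_algEquiv`, `Brandt.XiSetup.mem_ramifiedPlaces_iff`,
  `Brandt.XiSetup.nplus_ne_zero'` — bookkeeping (isomorphic algebras; the ramification clause in
  the `EichlerPackage` form; `N⁺ ≠ 0`);
* `Brandt.XiSetup.exists_connectingIdeal` — after identifying the algebras by an isomorphism
  `e`, there is an invertible right `e(S.O)`-ideal with left order `S'.O`;
* `Brandt.XiSetup.exists_classSetEquiv` — **`ε : Cls S.O ≃ Cls S'.O` with
  `weight S'.O (ε c) = weight S.O c` and `matrix S'.O n (ε c) (ε d) = matrix S.O n c d` for all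
  `n`** (transport along `e`, `Brandt.exists_classSetEquiv_map_ringEquiv`, then along the
  connecting ideal, `Brandt.exists_classSetEquiv_leftOrder`);
* `Brandt.XiSetup.natCard_classSet_eq` — the class number of type `(N⁺, N⁻)` is well defined;
* `brandtXi_eq_xiOfOrder` — `brandtXi N⁺ N⁻ λ = xiOfOrder O (N⁺N⁻) λ` for the Eichler order of
  any setup.

## References

* M.-F. Vignéras, *Arithmétique des algèbres de quaternions*, LNM 800 (1980), Ch. III §3
  Thm. 3.1, §5 B and remark after Cor. 5.5 [VignerasLNM800].
* R. Pollack, T. Weston, Compos. Math. 147 (2011), §2.1 [PollackWeston2011].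
* B. H. Gross, *Heights and the special values of L-series* (1987), §§1–3 [Gross1987].
-/

noncomputable section

open scoped Pointwise
open NumberField IsDedekindDomain

namespace Literature.NumberTheory.Automorphic

variable {Nplus Nminus : ℕ}

/-- The algebras of two Brandt setups with the same `N⁻` are isomorphic (uniqueness of the
quaternion algebra over `ℚ` ramified exactly at the primes dividing `N⁻` and at `∞`;
`nonempty_algEquiv_of_ramifiedPlaces_eq_holds`). [cite: VignerasLNM800, Ch. III §3 Thm. 3.1] -/
theorem Brandt.XiSetup.nonempty_algEquiv {Nplus' : ℕ} (S : Brandt.XiSetup Nplus Nminus)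
    (S' : Brandt.XiSetup Nplus' Nminus) : Nonempty (S.D ≃ₐ[ℚ] S'.D) := by
  refine nonempty_algEquiv_of_ramifiedPlaces_eq_holds ℚ S.D S'.D
    (S.ramifiedPlaces_eq.trans S'.ramifiedPlaces_eq.symm) ?_
  rw [show ramifiedInfinitePlaces ℚ S.D = Set.univ from
      Set.eq_univ_iff_forall.mpr fun w => S.isTotallyDefinite w,
    show ramifiedInfinitePlaces ℚ S'.D = Set.univ from
      Set.eq_univ_iff_forall.mpr fun w => S'.isTotallyDefinite w]

/-- The ramification clause of a setup in the `EichlerPackage` form `v ∈ Ram ↔ (N⁻) ⊆ v`.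
[folklore] -/
theorem Brandt.XiSetup.mem_ramifiedPlaces_iff (S : Brandt.XiSetup Nplus Nminus)
    (v : HeightOneSpectrum (𝓞 ℚ)) :
    v ∈ ramifiedPlaces ℚ S.D ↔ ((Nminus : ℕ) : 𝓞 ℚ) ∈ v.asIdeal := by
  rw [S.ramifiedPlaces_eq, Set.mem_setOf_eq, primesEquiv_dvd_iff]

/-- `N⁺ ≠ 0` for the type of a Brandt setup (a finite index of full lattices; cf.
`Brandt.XiSetup.nplus_ne_zero` of `EichlerSubidealCount.lean`, re-derived to keep imports light).
[folklore] -/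
theorem Brandt.XiSetup.nplus_ne_zero' (S : Brandt.XiSetup Nplus Nminus) : Nplus ≠ 0 := by
  haveI : IsAddTorsionFree S.D := isAddTorsionFree_of_charZero_module ℚ S.D
  obtain ⟨O₁, O₂, h₁, -, -, hidx⟩ := S.isEichlerOrder
  rw [← hidx]
  exact relIndex_ne_zero_of_isFullLattice S.isEichlerOrder.isOrder.isFullLattice
    h₁.1.isFullLattice.1

/-- **Connecting ideal across setups**: for setups `S, S'` of type `(N⁺, N⁻)` and an isomorphism
`e : S.D ≃ S'.D` of their algebras there is an invertible right `e(S.O)`-ideal whose left order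
is `S'.O` (the Eichler orders of level `N⁺` form one genus; Vignéras III §5, remark after
Cor. 5.5: "Deux ordres d'Eichler de même niveau étant toujours liés par un idéal"). [cite: VignerasLNM800, Ch. III §5 remark after Cor. 5.5] -/
theorem Brandt.XiSetup.exists_connectingIdeal (S S' : Brandt.XiSetup Nplus Nminus) (e : S.D ≃+* S'.D) :
    ∃ I : Submodule ℤ S'.D,
      IsInvertibleRightIdeal (S.O.map (e.toAddEquiv.toIntLinearEquiv : S.D →ₗ[ℤ] S'.D)) I ∧
        leftOrderOf I = S'.O := by
  have hdiv : ∀ y : S'.D, y ≠ 0 → IsUnit y := fun y hy =>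
    isUnit_of_isTotallyDefinite S'.D S'.isTotallyDefinite hy
  have hO₁ : Literature.NumberTheory.Automorphic.IsEichlerOrder
      (S.O.map (e.toAddEquiv.toIntLinearEquiv : S.D →ₗ[ℤ] S'.D)) Nplus :=
    isEichlerOrder_iff_brandt.mpr (S.isEichlerOrder.map_ringEquiv e)
  have hO₂ : Literature.NumberTheory.Automorphic.IsEichlerOrder S'.O Nplus :=
    isEichlerOrder_iff_brandt.mpr S'.isEichlerOrder
  exact hO₁.exists_isInvertibleRightIdeal_leftOrderOf_eq hdiv hO₂ S.nplus_ne_zero'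

/-- **The Brandt data of type `(N⁺, N⁻)` are canonical up to reindexing**: for any two setups
`S, S'` there is a bijection `ε : Cls S.O ≃ Cls S'.O` of class sets with
`weight S'.O (ε c) = weight S.O c` and `matrix S'.O n (ε c) (ε d) = matrix S.O n c d` for all `n`
(transport along an isomorphism of the algebras, `Brandt.exists_classSetEquiv_map_ringEquiv`, then
along a connecting ideal, `Brandt.exists_classSetEquiv_leftOrder`). In particular the class number,
the weights and all Brandt matrices of "the" Eichler order of level `N⁺` in "the" definite
quaternion algebra of discriminant `N⁻` are well defined. [cite: VignerasLNM800, Ch. III §5 B] [cite: PollackWeston2011, §2.1] -/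
theorem Brandt.XiSetup.exists_classSetEquiv (S S' : Brandt.XiSetup Nplus Nminus) :
    ∃ ε : Brandt.ClassSet S.O ≃ Brandt.ClassSet S'.O,
      (∀ c, Brandt.weight S'.O (ε c) = Brandt.weight S.O c) ∧
      ∀ n c d, Brandt.matrix S'.O n (ε c) (ε d) = Brandt.matrix S.O n c d := by
  obtain ⟨e⟩ := S.nonempty_algEquiv S'
  obtain ⟨ε₁, -, hw₁, hT₁⟩ := Brandt.exists_classSetEquiv_map_ringEquiv e.toRingEquiv S.O
  obtain ⟨I, hI, hIO⟩ := S.exists_connectingIdeal S' e.toRingEquiv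
  have hO₁ : Brandt.IsOrder S'.D
      (S.O.map (e.toRingEquiv.toAddEquiv.toIntLinearEquiv : S.D →ₗ[ℤ] S'.D)) :=
    (S.isEichlerOrder.map_ringEquiv e.toRingEquiv).isOrder
  have hImem : I ∈ Brandt.rightIdeals
      (S.O.map (e.toRingEquiv.toAddEquiv.toIntLinearEquiv : S.D →ₗ[ℤ] S'.D)) := by
    rw [rightIdeals_eq_invertibleRightIdeals_of_isTotallyDefinite S'.isTotallyDefinite
      (isZOrder_iff_isOrder.mpr hO₁)]
    exact hI
  -- `leftOrder I = leftOrderOf I = S'.O`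
  have hIO' : Brandt.leftOrder I = S'.O := hIO
  obtain ⟨ε₂, hw₂, hT₂⟩ :
      ∃ ε₂ : Brandt.ClassSet (S.O.map (e.toRingEquiv.toAddEquiv.toIntLinearEquiv : S.D →ₗ[ℤ] S'.D)) ≃
          Brandt.ClassSet S'.O,
        (∀ c, Brandt.weight S'.O (ε₂ c) =
          Brandt.weight (S.O.map (e.toRingEquiv.toAddEquiv.toIntLinearEquiv : S.D →ₗ[ℤ] S'.D)) c) ∧
        ∀ n c d, Brandt.matrix S'.O n (ε₂ c) (ε₂ d) =
          Brandt.matrix (S.O.map (e.toRingEquiv.toAddEquiv.toIntLinearEquiv : S.D →ₗ[ℤ] S'.D)) n c d := by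
    rw [← hIO']
    exact Brandt.exists_classSetEquiv_leftOrder S'.isTotallyDefinite hO₁ hImem
  exact ⟨ε₁.trans ε₂, fun c => by rw [Equiv.trans_apply, hw₂, hw₁],
    fun n c d => by rw [Equiv.trans_apply, Equiv.trans_apply, hT₂, hT₁]⟩

/-- **The class number of type `(N⁺, N⁻)` is well defined**: any two setups have equinumerous
class sets. [cite: VignerasLNM800, Ch. III §5 B] -/
theorem Brandt.XiSetup.natCard_classSet_eq (S S' : Brandt.XiSetup Nplus Nminus) :
    Nat.card (Brandt.ClassSet S'.O) = Nat.card (Brandt.ClassSet S.O) := by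
  obtain ⟨ε, -, -⟩ := S.exists_classSetEquiv S'
  exact Nat.card_congr ε.symm

/-- `brandtXi N⁺ N⁻ λ = xiOfOrder O (N⁺N⁻) λ` for the Eichler order `O` of ANY setup of type
`(N⁺, N⁻)` (`Brandt.XiSetup.brandtXi_eq_xi`, unfolded). [cite: PollackWeston2011, §2.1] -/
theorem brandtXi_eq_xiOfOrder (S : Brandt.XiSetup Nplus Nminus) (lam : ℕ → ℤ) :
    brandtXi Nplus Nminus lam = Brandt.xiOfOrder S.O (Nplus * Nminus) lam :=
  Brandt.XiSetup.brandtXi_eq_xi S lam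

end Literature.NumberTheory.Automorphic

end
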